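import Summits.ABC.IUTFork.Repair.RHSlotReach
import Summits.ABC.IUTFork.Repair.RHLevelMover
import HarnessLib

/-!
# D-0079 RESCUE sub-cell R-H, ROUND 1 row 15 «slotreach» — the k2 GLUE: the mover lemma `multiReach_of_slotReachWindow` that
# abc-iut-lens-wuc-1 left sorried (`HStar-slotreach.lean:131`) PROVED, hence H⋆ ⟹ MULTI-REACH ⟹ licence / S_H at `settingPrVolSharp`

PROOF-ONLY companion (D-0012: 0 definitions, 0 `Prop` facts) of abc-iut-rh-typ-12's `Repair/RHSlotReach.lean` (p457641: the candidate
`SlotReachWindow` of abc-iut-lens-wuc-1, `staging/RH/lens-wuc-1/HStar-slotreach.lean` b131cdee138fbe71, typed VERBATIM) and of this seat's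
one-place engine `Repair/RHLevelMover.lean`; abc-iut cell, rung LADDER-ABC:A2.RP → A2.RESCUE-H; seat abc-iut-rp-d3 gen 5 = R-H ROUND 1
«k2 DESK hand» for row 15 (abc-iut-rh-lead D-0107; bridge: abc-iut-lens-wuc-2 `CANDIDATE.md` §B 157eed710a15e618). TAKES NO SIDE on
[IUTchIII] Cor. 3.12 or on any author (Mochizuki / Scholze–Stix / Joshi / Dupuy–Hilado): `SlotReachWindow` is an R-H CANDIDATE = a
HYPOTHESIS SHAPE, never asserted, never a Literature fact; typed ≠ proved; instantiated ≠ endorsed. No new `Prop` fact: inputs consumed BY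
NAME — `RHLevelMover.exists_mover_of_not_mem_logUnits_fibre` (abc-iut-w5-d180's (Ind2)-transitivity `exists_mem_ismDH_apply_eq_of_primitive`
+ campaign-S's compact-open lattice `log_p(𝒪^×)`), abc-iut-w5-d107's `qRegion_subset_thetaHull_settingDHVolSharp_of_multiReach` /
`licence_settingPrVolSharp_of_multiReach`, abc-iut-w5-d236's `…_of_movers` / `exists_mover_of_norm_le`, `qRegion_subset_thetaHull_settingDHVolSharp_inl`,
C-cert-1's `Conditional.Antecedent.exists_qPinned_and_hull_iff`.

THE MOVER LEMMA (`RHLevelMover`, any finite place, any ramification, `p = 2` allowed; the content of wuc-2's §B (1)–(3)). Let `Λ = log_p(𝒪_v^×) ⊂ K_v`.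
If `u ∉ Λ` and `s := p^{1−C}·u`, then `s` lies on an EXACT level `k ≥ C` of `Λ` (`p^k s ∈ Λ ∌ p^{k−1} s`: the levels of `s` are
up-closed because `p·Λ ⊆ Λ`, non-empty because `Λ ⊇ {‖z‖ ≤ p⁻²}`, bounded below by `C` because `p^{C−1} s = u ∉ Λ`); a vector `z₀` of
LARGEST norm in `Λ` (compactness) is PRIMITIVE (`z₀ ∉ p·Λ`); so (Ind2)-transitivity on the primitive vectors of `p^{−k}·Λ` carries `s` to
`p^{−k}·z₀`, of norm `p^k·‖z₀‖ ≥ p^C·‖z‖` for EVERY `z ∈ Λ` (`exists_mover_of_not_mem_logUnits`). No evaluation of `Λ` is needed: the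
dictionary's `n₀(x)` enters only through the non-log-unit `u_x` with `‖u_x‖ ≤ ‖ϖ_x‖^{n₀−1}` (a certificate FROM BELOW of the inner
conductor) and `λ_x` only through one `z_x ∈ Λ_x` with `‖z_x‖ ≥ p^{λ_x}` — exactly the lens's hypotheses `hsharp` / `hrad`.

THE MULTI-REACH LEMMA (§1, `multiReach_of_slotReachWindow`; the lens's statement with ONE added hypothesis `htq1`: «`‖t_{q,x}‖ = 1` at the
places `x ∉ S`», a binder of the setting itself, available at every call site — without it the conclusion is not provable at a packet
whose last slot sits at a GOOD place, where the window says nothing). At a packet `(p, i, e⃗)` with last slot at a BAD place `w`: donor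
slot `a` at `x_a` carries `y_a := p^{1−C_a}·u_{x_a}`, `C_a = ⌈n₀(x_a)/e_{x_a}⌉` (`‖y_a‖ ≤ 1` iff `e·C ≤ n₀ + e − 1` ✓), moved to norm
`≥ p^{C_a + λ_{x_a}}`; the last slot carries `t_Θ·y'` with `t_Θ·y' = p^{1−c}·u_w`, `c = ⌈(n₀(w) − m_Θ)/e_w⌉ = −⌊(m_Θ − n₀(w))/e_w⌋`
(`‖y'‖ ≤ 1` iff `e·c ≤ n₀ − m_Θ + e − 1` ✓), moved to norm `≥ p^{c + λ_w}`; the product of the reached norms is `≥ p^{c + λ_w + Σ_a (C_a + λ_{x_a})}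
≥ p^{−m_q/e_w} = ‖t_{q,w}‖` — the last step IS the `(w, i, x⃗)`-clause of `SlotReachWindow`. At a GOOD last place: identity movers,
`y = 1`, product `= ‖t_{Θ,i,w}‖ = 1 = ‖t_{q,w}‖`.

HONEST SCOPE. OUR typed objects throughout: Dupuy–Hilado's (Ind2) = ALL `ℤ_p`-lattice automorphisms of the log-shell (STRONGER-THAN-PRINT),
abc-iut-c312-7's SHARP pilot boxes, the hull-level reading of Step (xi-f) (ADJUDICATION-SPEC §2 (G1′): stronger than the printed global
inequality); nothing here decides a cell of any table, evaluates `n₀`/`λ` at any field, or bears on `Cor22.Cor312AtDatum`; H⋆ ⟹ S_H is a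
theorem about a HYPOTHESIS. [cite: WeilBNT1967, Ch. II §2, Th. 1] [cite: DupuyHilado2025, §3.9, §4.7, §4.9]
[cite: Mochizuki2012, IUTchIV Prop. 1.2 (i) p. 10; IUTchIII Cor. 3.12 Step (xi-f) p. 184] [claim: Mochizuki2012, status: disputed]
-/

noncomputable section

open Set Function
open scoped Pointwise


/-! ## §1. The sharp settings: the multi-reach lemma (the lens's sorried `:131`, proved) -/

namespace Summit.ABC.IUTFork.Repair.RHSlotReachGlue

open Thm311 Thm311.Real Cor312 Cor312.Setting Cor312Vol Literature.IUT.LogThetaLattice Literature.IUT.LogVolume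
open Literature.NumberTheory.NumberFields NumberField IsDedekindDomain Metric RHLevelMover RHSlotReach

section Setting

variable {F : Type} [Field F] [NumberField F] (X : PilotData F) {logv : PadicLogs F} (hlog : LogvAnalytic logv)
  (M : Type) [Field M] [NumberField M]
  (archPk : ∀ (j : (thetaIndex X).Label) (vQ : (thetaIndex X).VQ), Set ((logShellsDH X logv).Packet j vQ))
  (archSub : ∀ (j : (thetaIndex X).Label) (v : (thetaIndex X).V),
    Set ((logShellsDH X logv).Packet j ((thetaIndex X).over v)))
  (Ψ : ℤ → ∀ v : (thetaIndex X).V, v ∈ (thetaIndex X).Vbad → Set ((logShellsDH X logv).StarPacket v))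
  (act : ℤ → ∀ v : (thetaIndex X).V, v ∈ (thetaIndex X).Vbad →
    (logShellsDH X logv).StarPacket v → Module.End ℚ ((logShellsDH X logv).StarPacket v))
  (Mmod : ℤ → ∀ j : (thetaIndex X).LabelStar, Set ((logShellsDH X logv).GlobalPacket j.1))
  (region : ℤ → ∀ j : (thetaIndex X).LabelStar, FinDivisor M → ∀ vQ : (thetaIndex X).VQ,
    Set ((logShellsDH X logv).Packet j.1 vQ))
  (n : ℤ) {HT : Type} {LogLink : HT → HT → Type} {IsFull : ∀ {s t : HT}, LogLink s t → Prop}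
  (lat : LGPGaussianLogThetaLattice LogLink IsFull)
  {Frd : Type} {IsoF : Frd → Frd → Type} {Ob : Frd → Type} {realify : Frd → Frd} {Strip : Type}
  {IsoS : Strip → Strip → Type} {Mv : ∀ v : (thetaIndex X).V, v ∈ (thetaIndex X).Vbad → Type}
  [∀ v h, Monoid (Mv v h)]
  (sig : GlobalLGPFrobenioidSignature (thetaIndex X).lstar (thetaIndex X).V (· ∈ (thetaIndex X).Vbad)
    Frd IsoF Ob realify Strip IsoS Mv)
  (split : SplittingMonoids Mv) {ObΔ : Type} {N : ∀ v : (thetaIndex X).V, v ∈ (thetaIndex X).Vbad → Type}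
  [∀ v h, Monoid (N v h)] (qData : QPilotData ObΔ N)
  (tq : ∀ (pp : Nat.Primes) (x : (thetaIndex X).Fibre (.inr pp)), haveI : Fact (pp : ℕ).Prime := ⟨pp.2⟩; kOf X pp.1 x)
  (t : ∀ (pp : Nat.Primes) (_ : Fin X.lstar) (x : (thetaIndex X).Fibre (.inr pp)),
    haveI : Fact (pp : ℕ).Prime := ⟨pp.2⟩; kOf X pp.1 x)
  (htq0 : ∀ pp x, tq pp x ≠ 0)
  (htq1 : ∀ (pp : Nat.Primes) (x : (thetaIndex X).Fibre (.inr pp)),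
    haveI : Fact (pp : ℕ).Prime := ⟨pp.2⟩; placeOf X pp.1 x ∉ X.S → ‖tq pp x‖ = 1)
  (col : ℤ → Column (logShellsDH X logv))
  -- the numeric dictionary of H⋆ (abc-iut-lens-wuc-1): per place `x | p` a uniformizer, the certified inner conductor and outer radius
  (e n₀ : ∀ pp : Nat.Primes, (thetaIndex X).Fibre (.inr pp) → ℕ)
  (lam : ∀ pp : Nat.Primes, (thetaIndex X).Fibre (.inr pp) → ℝ)
  (ϖ : ∀ (pp : Nat.Primes) (x : (thetaIndex X).Fibre (.inr pp)), haveI : Fact (pp : ℕ).Prime := ⟨pp.2⟩; kOf X pp.1 x)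
  (mΘ : ∀ pp : Nat.Primes, Fin (thetaIndex X).lstar → (thetaIndex X).Fibre (.inr pp) → ℤ)
  (mq : ∀ pp : Nat.Primes, (thetaIndex X).Fibre (.inr pp) → ℤ)

/-- **MULTI-REACH FROM THE SLOT-REACH WINDOW** — the mover lemma abc-iut-lens-wuc-1 left sorried (`HStar-slotreach.lean:131`), with the
one added binder `htq1` (‖t_{q,x}‖ = 1 off `S`; see the module docstring). At a packet `(p, i, e⃗)` whose last slot sits at a BAD place
`w`: donor slot `a` at `x_a` carries `y_a = p^{1−C_a}·u_{x_a}`, `C_a = ⌈n₀(x_a)/e_{x_a}⌉`, reached norm `≥ p^{C_a + λ_{x_a}}`; the last slot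
carries `t_Θ·y' = p^{1−c}·u_w`, `c = −⌊(m_Θ − n₀(w))/e_w⌋`, reached norm `≥ p^{c + λ_w}`; the product dominates `‖t_{q,w}‖ = p^{−m_q/e_w}`
by the window clause. At a GOOD `w`: identity movers. [cite: WeilBNT1967, Ch. II §2, Th. 1] [cite: DupuyHilado2025, §3.9, §4.9]
[claim: Mochizuki2012, status: disputed] -/
theorem multiReach_of_slotReachWindow
    (htq1 : ∀ (pp : Nat.Primes) (x : (thetaIndex X).Fibre (.inr pp)),
      haveI : Fact (pp : ℕ).Prime := ⟨pp.2⟩; placeOf X pp.1 x ∉ X.S → ‖tq pp x‖ = 1)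
    (he : ∀ pp x, 1 ≤ e pp x)
    (hϖ : ∀ (pp : Nat.Primes) (x : (thetaIndex X).Fibre (.inr pp)), haveI : Fact (pp : ℕ).Prime := ⟨pp.2⟩
      ‖ϖ pp x‖ = (pp : ℝ) ^ (-(1 : ℝ) / (e pp x : ℝ)))
    (hsharp : ∀ (pp : Nat.Primes) (x : (thetaIndex X).Fibre (.inr pp)), haveI : Fact (pp : ℕ).Prime := ⟨pp.2⟩
      ∃ u : kOf X pp.1 x, ‖u‖ ≤ ‖ϖ pp x‖ ^ ((n₀ pp x : ℤ) - 1) ∧ u ∉ (logUnits (kOf X pp.1 x) : Set (kOf X pp.1 x)))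
    (hrad : ∀ (pp : Nat.Primes) (x : (thetaIndex X).Fibre (.inr pp)), haveI : Fact (pp : ℕ).Prime := ⟨pp.2⟩
      ∃ z ∈ (logUnits (kOf X pp.1 x) : Set (kOf X pp.1 x)), (pp : ℝ) ^ (lam pp x) ≤ ‖z‖)
    (ht1 : ∀ (pp : Nat.Primes) (i : Fin X.lstar) (x : (thetaIndex X).Fibre (.inr pp)),
      haveI : Fact (pp : ℕ).Prime := ⟨pp.2⟩; placeOf X pp.1 x ∉ X.S → ‖t pp i x‖ = 1)
    (hΘ : ∀ (pp : Nat.Primes) (i : Fin X.lstar) (w : (thetaIndex X).Fibre (.inr pp)), haveI : Fact (pp : ℕ).Prime := ⟨pp.2⟩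
      placeOf X pp.1 w ∈ X.S → ‖t pp i w‖ = ‖ϖ pp w‖ ^ (mΘ pp i w))
    (hq : ∀ (pp : Nat.Primes) (w : (thetaIndex X).Fibre (.inr pp)), haveI : Fact (pp : ℕ).Prime := ⟨pp.2⟩
      placeOf X pp.1 w ∈ X.S → ‖tq pp w‖ = ‖ϖ pp w‖ ^ (mq pp w))
    (hH : SlotReachWindow (thetaIndex X).lstar (fun pp => (thetaIndex X).Fibre (.inr pp))
      (fun pp w => haveI : Fact (pp : ℕ).Prime := ⟨pp.2⟩; placeOf X pp.1 w ∈ X.S) e n₀ lam mΘ mq)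
    (pp : Nat.Primes) (i : Fin (thetaIndex X).lstar)
    (ev : (thetaIndex X).Caps (Setting.labelSucc i) → (thetaIndex X).Fibre (.inr pp)) :
    haveI : Fact (pp : ℕ).Prime := ⟨pp.2⟩
    ∃ g : (thetaIndex X).Caps (Setting.labelSucc i) → ∀ x : (thetaIndex X).Fibre (.inr pp),
        (logShellsDH X logv).carrier x.1 ≃ₗ[ℚ] (logShellsDH X logv).carrier x.1,
      (∀ a x, g a x ∈ (logShellsDH X logv).ism x.1) ∧
      ∃ y : ∀ a, kOf X pp.1 (ev a), (∀ a, ‖y a‖ ≤ 1) ∧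
        ‖tq pp (ev (Fin.last _))‖ ≤ ∏ a, ‖(presAt X hlog pp).φ (ev a) (g a (ev a) (((presAt X hlog pp).φ (ev a)).symm
          ((if a = Fin.last _ then t pp i (ev a) else 1) * y a)))‖ := by
  haveI : Fact (pp : ℕ).Prime := ⟨pp.2⟩
  classical
  have hp1 : (1 : ℝ) < (pp : ℕ) := by exact_mod_cast pp.2.one_lt
  have hp0 : (0 : ℝ) < (pp : ℕ) := by positivity
  set P := presAt X hlog pp with hP
  set w := ev (Fin.last _) with hwdef
  by_cases hw : placeOf X pp.1 w ∈ X.S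
  swap
  · -- GOOD last place: identity movers, `y = 1`
    refine ⟨fun _ _ => LinearEquiv.refl ℚ _, fun _ x => (logShellsDH X logv).one_mem_ism x.1, fun _ => 1,
      fun _ => norm_one.le, ?_⟩
    have hprod : ∏ a, ‖P.φ (ev a) ((LinearEquiv.refl ℚ _)
        ((P.φ (ev a)).symm ((if a = Fin.last _ then t pp i (ev a) else 1) * (1 : kOf X pp.1 (ev a)))))‖ = 1 := by
      refine Finset.prod_eq_one fun a _ => ?_
      rw [mul_one, LinearEquiv.refl_apply, LinearEquiv.apply_symm_apply]
      split_ifs with ha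
      · rw [ha]; exact ht1 pp i w hw
      · exact (norm_one (α := kOf X pp.1 (ev a)))
    rw [hprod, htq1 pp w hw]
  · -- BAD last place: the level movers
    -- the dictionary at the places over `p`
    choose u hu_norm hu_not using hsharp pp
    choose z hz_mem hz_norm using hrad pp
    -- slot exponents: `c` on the last slot (at `x`), `C_x` on the donor slots
    let κ : (thetaIndex X).Caps (Setting.labelSucc i) → (thetaIndex X).Fibre (.inr pp) → ℤ := fun a x =>
      if a = Fin.last _ then -((mΘ pp i x - n₀ pp x) / (e pp x : ℤ)) else -((-(n₀ pp x : ℤ)) / (e pp x : ℤ))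
    -- slot vectors `s_{a,x} = p^{1-κ} • u_x`
    let s : ∀ (a : (thetaIndex X).Caps (Setting.labelSucc i)) (x : (thetaIndex X).Fibre (.inr pp)), kOf X pp.1 x :=
      fun a x => ((pp : ℚ_[pp]) ^ (1 - κ a x)) • u x
    have hs : ∀ a x, ((pp : ℚ_[pp]) ^ (κ a x - 1)) • s a x = u x := by
      intro a x
      show ((pp : ℚ_[pp]) ^ (κ a x - 1)) • (((pp : ℚ_[pp]) ^ (1 - κ a x)) • u x) = u x
      rw [smul_smul, ← zpow_add₀ (Nat.cast_ne_zero.2 pp.2.ne_zero), show κ a x - 1 + (1 - κ a x) = 0 by ring,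
        zpow_zero, one_smul]
    -- movers on every slot and place
    have hmov : ∀ (a : (thetaIndex X).Caps (Setting.labelSucc i)) (x : (thetaIndex X).Fibre (.inr pp)),
        ∃ g ∈ (logShellsDH X logv).ism x.1,
          ((pp : ℕ) : ℝ) ^ (κ a x) * ‖z x‖ ≤ ‖P.φ x (g ((P.φ x).symm (s a x)))‖ := fun a x =>
      exists_mover_of_not_mem_logUnits_fibre X hlog pp x (hs a x) (hu_not x) (hz_mem x)
    choose g hg hreach using hmov
    -- the Θ-idele at the bad last place is nonzero
    have hϖpos : ∀ x, 0 < ‖ϖ pp x‖ := fun x => by rw [hϖ pp x]; exact Real.rpow_pos_of_pos hp0 _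
    have ht0 : t pp i w ≠ 0 := by
      rw [← norm_pos_iff, hΘ pp i w hw]; exact zpow_pos (hϖpos w) _
    -- the box points
    let y : ∀ a, kOf X pp.1 (ev a) := fun a => if a = Fin.last _ then (t pp i (ev a))⁻¹ * s a (ev a) else s a (ev a)
    have hcy : ∀ a, (if a = Fin.last _ then t pp i (ev a) else 1) * y a = s a (ev a) := by
      intro a
      show (if a = Fin.last _ then t pp i (ev a) else 1) *
          (if a = Fin.last _ then (t pp i (ev a))⁻¹ * s a (ev a) else s a (ev a)) = s a (ev a)
      split_ifs with ha
      · subst ha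
        rw [← mul_assoc, mul_inv_cancel₀ ht0, one_mul]
      · rw [one_mul]
    -- norms in `p`-exponent form
    have hnorm_s : ∀ a x, ‖s a x‖ = ((pp : ℕ) : ℝ) ^ (κ a x - 1) * ‖u x‖ := by
      intro a x
      show ‖((pp : ℚ_[pp]) ^ (1 - κ a x)) • u x‖ = _
      rw [norm_zpow_prime_smul, neg_sub]
    have hϖzpow : ∀ (x : (thetaIndex X).Fibre (.inr pp)) (m : ℤ),
        ‖ϖ pp x‖ ^ m = ((pp : ℕ) : ℝ) ^ (-(m : ℝ) / (e pp x : ℝ)) := by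
      intro x m
      rw [← Real.rpow_intCast, hϖ pp x, ← Real.rpow_mul hp0.le]
      congr 1; ring
    have he0 : ∀ x, (0 : ℝ) < (e pp x : ℝ) := fun x => by exact_mod_cast he pp x
    -- `‖u_x‖ ≤ p^{-(n₀-1)/e}`
    have hu_le : ∀ x, ‖u x‖ ≤ ((pp : ℕ) : ℝ) ^ (-(((n₀ pp x : ℤ) - 1 : ℤ) : ℝ) / (e pp x : ℝ)) := fun x => by
      have h := hu_norm x; rwa [hϖzpow] at h
    -- the box constraints `‖y_a‖ ≤ 1`
    have hy : ∀ a, ‖y a‖ ≤ 1 := by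
      intro a
      by_cases ha : a = Fin.last _
      · -- last slot: ‖t⁻¹ s‖ = p^{c-1} ‖u_w‖ / ‖ϖ_w‖^{mΘ} ≤ 1
        have hya : y a = (t pp i (ev a))⁻¹ * s a (ev a) := if_pos ha
        subst ha
        rw [hya, norm_mul, norm_inv, hnorm_s, hΘ pp i w hw, hϖzpow]
        have hκ : κ (Fin.last _) w = -((mΘ pp i w - n₀ pp w) / (e pp w : ℤ)) := if_pos rfl
        have hint : (e pp w : ℤ) * κ (Fin.last _) w ≤ (n₀ pp w : ℤ) - mΘ pp i w + e pp w - 1 := by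
          rw [hκ, show mΘ pp i w - n₀ pp w = -((n₀ pp w : ℤ) - mΘ pp i w) by ring]
          exact mul_neg_ediv_neg_le (e pp w) (he pp w) _
        have hint' : (e pp w : ℝ) * (κ (Fin.last _) w : ℝ) ≤ (n₀ pp w : ℝ) - (mΘ pp i w : ℝ) + (e pp w : ℝ) - 1 := by
          exact_mod_cast hint
        have hdiv : (κ (Fin.last _) w : ℝ) - 1 ≤ ((n₀ pp w : ℝ) - 1) / (e pp w : ℝ) - (mΘ pp i w : ℝ) / (e pp w : ℝ) := by
          rw [← sub_div, le_div_iff₀ (he0 w)]; linarith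
        calc (((pp : ℕ) : ℝ) ^ (-((mΘ pp i w : ℤ) : ℝ) / (e pp w : ℝ)))⁻¹ *
              (((pp : ℕ) : ℝ) ^ (κ (Fin.last _) w - 1) * ‖u w‖)
            ≤ (((pp : ℕ) : ℝ) ^ (-((mΘ pp i w : ℤ) : ℝ) / (e pp w : ℝ)))⁻¹ *
              (((pp : ℕ) : ℝ) ^ (κ (Fin.last _) w - 1) *
                ((pp : ℕ) : ℝ) ^ (-(((n₀ pp w : ℤ) - 1 : ℤ) : ℝ) / (e pp w : ℝ))) := by
              gcongr; exact hu_le w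
          _ ≤ 1 := by
              rw [← Real.rpow_neg hp0.le, ← Real.rpow_intCast, ← Real.rpow_add hp0, ← Real.rpow_add hp0]
              refine Real.rpow_le_one_of_one_le_of_nonpos hp1.le ?_
              push_cast
              simp only [neg_div, neg_neg]
              linarith
      · -- donor slot: ‖s‖ = p^{C-1} ‖u_x‖ ≤ 1
        have hya : y a = s a (ev a) := if_neg ha
        rw [hya, hnorm_s]
        set x := ev a with hxdef
        have hκ : κ a x = -((-(n₀ pp x : ℤ)) / (e pp x : ℤ)) := if_neg ha
        have hint : (e pp x : ℤ) * κ a x ≤ (n₀ pp x : ℤ) + e pp x - 1 := by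
          rw [hκ]; exact mul_neg_ediv_neg_le (e pp x) (he pp x) _
        have hint' : (e pp x : ℝ) * (κ a x : ℝ) ≤ (n₀ pp x : ℝ) + (e pp x : ℝ) - 1 := by exact_mod_cast hint
        have hdiv : (κ a x : ℝ) - 1 ≤ ((n₀ pp x : ℝ) - 1) / (e pp x : ℝ) := by
          rw [le_div_iff₀ (he0 x)]; linarith
        calc ((pp : ℕ) : ℝ) ^ (κ a x - 1) * ‖u x‖
            ≤ ((pp : ℕ) : ℝ) ^ (κ a x - 1) * ((pp : ℕ) : ℝ) ^ (-(((n₀ pp x : ℤ) - 1 : ℤ) : ℝ) / (e pp x : ℝ)) := by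
              gcongr; exact hu_le x
          _ ≤ 1 := by
              rw [← Real.rpow_intCast, ← Real.rpow_add hp0]
              refine Real.rpow_le_one_of_one_le_of_nonpos hp1.le ?_
              push_cast
              simp only [neg_div]
              linarith
    refine ⟨g, hg, y, hy, ?_⟩
    -- each factor dominates `p^{κ} · p^{λ}`
    have hfac : ∀ a, ((pp : ℕ) : ℝ) ^ ((κ a (ev a) : ℝ) + lam pp (ev a)) ≤
        ‖P.φ (ev a) (g a (ev a) ((P.φ (ev a)).symm ((if a = Fin.last _ then t pp i (ev a) else 1) * y a)))‖ := by
      intro a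
      rw [hcy a, Real.rpow_add hp0, Real.rpow_intCast]
      exact (mul_le_mul_of_nonneg_left (hz_norm (ev a)) (zpow_nonneg hp0.le _)).trans (hreach a (ev a))
    have hprod : ((pp : ℕ) : ℝ) ^ (∑ a, ((κ a (ev a) : ℝ) + lam pp (ev a))) ≤
        ∏ a, ‖P.φ (ev a) (g a (ev a) ((P.φ (ev a)).symm ((if a = Fin.last _ then t pp i (ev a) else 1) * y a)))‖ := by
      rw [Real.rpow_sum_of_pos hp0]
      exact Finset.prod_le_prod (fun a _ => (Real.rpow_pos_of_pos hp0 _).le) fun a _ => hfac a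
    refine le_trans ?_ hprod
    -- the window clause at `(w, i, donors)`
    have key : ((((mΘ pp i w - n₀ pp w) / (e pp w : ℤ) : ℤ) : ℝ))
        ≤ (mq pp w : ℝ) / (e pp w : ℝ) + lam pp w
          + ∑ a : Fin ((i : ℕ) + 1), (lam pp (ev (Fin.castSucc a))
            + ((-((-(n₀ pp (ev (Fin.castSucc a)) : ℤ)) / (e pp (ev (Fin.castSucc a)) : ℤ)) : ℤ) : ℝ)) :=
      hH pp i w hw fun a => ev (Fin.castSucc a)
    rw [hq pp w hw, hϖzpow]
    refine Real.rpow_le_rpow_of_exponent_le hp1.le ?_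
    -- split the slot sum: donors + last
    have hlast : κ (Fin.last _) (ev (Fin.last _)) = -((mΘ pp i w - n₀ pp w) / (e pp w : ℤ)) := if_pos rfl
    have hdon : ∀ a : Fin ((i : ℕ) + 1), κ (Fin.castSucc a) (ev (Fin.castSucc a))
        = -((-(n₀ pp (ev (Fin.castSucc a)) : ℤ)) / (e pp (ev (Fin.castSucc a)) : ℤ)) :=
      fun a => if_neg (Fin.castSucc_lt_last a).ne
    have hsplit : ∑ a, ((κ a (ev a) : ℝ) + lam pp (ev a))
        = (∑ a : Fin ((i : ℕ) + 1), (lam pp (ev (Fin.castSucc a))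
            + ((-((-(n₀ pp (ev (Fin.castSucc a)) : ℤ)) / (e pp (ev (Fin.castSucc a)) : ℤ)) : ℤ) : ℝ)))
          + (-((((mΘ pp i w - n₀ pp w) / (e pp w : ℤ) : ℤ) : ℝ)) + lam pp w) := by
      rw [Fin.sum_univ_castSucc, hlast, Int.cast_neg]
      congr 1
      exact Finset.sum_congr rfl fun a _ => by rw [hdon a, add_comm]
    rw [hsplit]
    set S := ∑ a : Fin ((i : ℕ) + 1), (lam pp (ev (Fin.castSucc a))
      + ((-((-(n₀ pp (ev (Fin.castSucc a)) : ℤ)) / (e pp (ev (Fin.castSucc a)) : ℤ)) : ℤ) : ℝ)) with hS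
    have hneg : -((mq pp w : ℤ) : ℝ) / (e pp w : ℝ) = -((mq pp w : ℝ) / (e pp w : ℝ)) := by rw [neg_div]
    rw [hneg]
    linarith [key]

/-! ## §2. The lens's k2 corollaries: `SlotReachWindow` ⟹ branch C's antecedent `∃ ρ qK, QPinned ∧ PilotKummerCompatHull` -/

/-- **k2: H⋆ ⟹ S_H** (abc-iut-lens-wuc-1's corollary, now sorry-free). Under the numeric dictionary, `SlotReachWindow` gives branch C's
hull-level antecedent `∃ ρ qK, QPinned ∧ PilotKummerCompatHull` at `settingPrVolSharp` (any columns; integral `t_q` for the label `0`), by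
`multiReach_of_slotReachWindow` + abc-iut-w5-d107 `qRegion_subset_thetaHull_settingDHVolSharp_of_multiReach` at the labels of `𝔽_l^⋇`,
abc-iut-w5-d236's trivial movers at the label `0`, and C-cert-1 `exists_qPinned_and_hull_iff`. [claim: Mochizuki2012, status: disputed]
[cite: DupuyHilado2025, §3.9, §4.9] -/
theorem exists_qPinned_and_hull_settingPrVolSharp_of_slotReachWindow (htqle : ∀ pp x, ‖tq pp x‖ ≤ 1)
    (he : ∀ pp x, 1 ≤ e pp x)
    (hϖ : ∀ (pp : Nat.Primes) (x : (thetaIndex X).Fibre (.inr pp)), haveI : Fact (pp : ℕ).Prime := ⟨pp.2⟩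
      ‖ϖ pp x‖ = (pp : ℝ) ^ (-(1 : ℝ) / (e pp x : ℝ)))
    (hsharp : ∀ (pp : Nat.Primes) (x : (thetaIndex X).Fibre (.inr pp)), haveI : Fact (pp : ℕ).Prime := ⟨pp.2⟩
      ∃ u : kOf X pp.1 x, ‖u‖ ≤ ‖ϖ pp x‖ ^ ((n₀ pp x : ℤ) - 1) ∧ u ∉ (logUnits (kOf X pp.1 x) : Set (kOf X pp.1 x)))
    (hrad : ∀ (pp : Nat.Primes) (x : (thetaIndex X).Fibre (.inr pp)), haveI : Fact (pp : ℕ).Prime := ⟨pp.2⟩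
      ∃ z ∈ (logUnits (kOf X pp.1 x) : Set (kOf X pp.1 x)), (pp : ℝ) ^ (lam pp x) ≤ ‖z‖)
    (ht1 : ∀ (pp : Nat.Primes) (i : Fin X.lstar) (x : (thetaIndex X).Fibre (.inr pp)),
      haveI : Fact (pp : ℕ).Prime := ⟨pp.2⟩; placeOf X pp.1 x ∉ X.S → ‖t pp i x‖ = 1)
    (hΘ : ∀ (pp : Nat.Primes) (i : Fin X.lstar) (w : (thetaIndex X).Fibre (.inr pp)), haveI : Fact (pp : ℕ).Prime := ⟨pp.2⟩
      placeOf X pp.1 w ∈ X.S → ‖t pp i w‖ = ‖ϖ pp w‖ ^ (mΘ pp i w))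
    (hq : ∀ (pp : Nat.Primes) (w : (thetaIndex X).Fibre (.inr pp)), haveI : Fact (pp : ℕ).Prime := ⟨pp.2⟩
      placeOf X pp.1 w ∈ X.S → ‖tq pp w‖ = ‖ϖ pp w‖ ^ (mq pp w))
    (hH : SlotReachWindow (thetaIndex X).lstar (fun pp => (thetaIndex X).Fibre (.inr pp))
      (fun pp w => haveI : Fact (pp : ℕ).Prime := ⟨pp.2⟩; placeOf X pp.1 w ∈ X.S) e n₀ lam mΘ mq) :
    ∃ (ρ : (∀ v : (thetaIndex X).V, v ∈ (thetaIndex X).Vbad → Set ((logShellsDH X logv).StarPacket v)) →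
          ∀ (j : (thetaIndex X).Label) (vQ : (thetaIndex X).VQ), Set ((logShellsDH X logv).Packet j vQ))
        (qK : ∀ v : (thetaIndex X).V, v ∈ (thetaIndex X).Vbad → Set ((logShellsDH X logv).StarPacket v)),
        QPinned ({ toSituation := situationPrVol X hlog M archPk archSub Ψ act Mmod region, col := col } :
            LatticeSituation (thetaIndex X))
          (settingPrVolSharp X hlog M archPk archSub Ψ act Mmod region n lat sig split qData tq t htq0 htq1) ρ qK ∧
        PilotKummerCompatHull ({ toSituation := situationPrVol X hlog M archPk archSub Ψ act Mmod region, col := col } :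
            LatticeSituation (thetaIndex X))
          (settingPrVolSharp X hlog M archPk archSub Ψ act Mmod region n lat sig split qData tq t htq0 htq1) ρ qK := by
  refine (Conditional.Antecedent.exists_qPinned_and_hull_iff
    ({ toSituation := situationPrVol X hlog M archPk archSub Ψ act Mmod region, col := col } : LatticeSituation (thetaIndex X))
    (settingPrVolSharp X hlog M archPk archSub Ψ act Mmod region n lat sig split qData tq t htq0 htq1)).2 fun j vQ => ?_
  haveI hne : ∀ pp : Nat.Primes, Fact (pp : ℕ).Prime := fun pp => ⟨pp.2⟩
  by_cases hj : 0 < (j : ℕ)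
  · -- a label of `𝔽_l^⋇`: multi-reach at every packet over every prime
    have hj' : j = labelSucc ⟨(j : ℕ) - 1, by have := j.2; simp only [thetaIndex] at this ⊢; omega⟩ := by
      ext; simp only [labelSucc, Fin.val_succ]; omega
    rw [hj']
    cases vQ with
    | inl u =>
      exact qRegion_subset_thetaHull_settingDHVolSharp_inl X hlog M archPk archSub Ψ act Mmod region n lat sig split qData tq t htq0
        htq1 (labelSucc _) u
    | inr pp =>
      exact qRegion_subset_thetaHull_settingDHVolSharp_of_multiReach X hlog M archPk archSub Ψ act Mmod region n lat sig split qData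
        tq t htq0 htq1 pp _ (multiReach_of_slotReachWindow X hlog tq t e n₀ lam ϖ mΘ mq htq1 he hϖ hsharp hrad ht1 hΘ hq hH pp _)
  · -- the label `0`: the Θ-idele is `1`, trivial movers for integral `t_q`
    refine qRegion_subset_thetaHull_settingDHVolSharp_of_movers X hlog M archPk archSub Ψ act Mmod region n lat sig split qData tq t
      htq0 htq1 j vQ fun pp x => exists_mover_of_norm_le X hlog tq t pp j x ?_
    unfold labelIdele
    rw [dif_neg hj, norm_one]
    exact htqle pp x

/-- **k2 (licence form): H⋆ ⟹ the (xi-f) LICENCE at `settingPrVolSharp`** — the labels of `𝔽_l^⋇` only, so no integrality of `t_q` is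
needed: `multiReach_of_slotReachWindow` + abc-iut-w5-d107 `licence_settingPrVolSharp_of_multiReach`. At a constant region-forming operator
`ρ := fun _ => qRegion` this IS branch C's hull clause at the labels `≥ 1` (abc-iut-rp-j2 `RHPlaceCutGlue` §1). [claim: Mochizuki2012, status: disputed]
[cite: DupuyHilado2025, §3.9, §4.9] -/
theorem licence_settingPrVolSharp_of_slotReachWindow
    (he : ∀ pp x, 1 ≤ e pp x)
    (hϖ : ∀ (pp : Nat.Primes) (x : (thetaIndex X).Fibre (.inr pp)), haveI : Fact (pp : ℕ).Prime := ⟨pp.2⟩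
      ‖ϖ pp x‖ = (pp : ℝ) ^ (-(1 : ℝ) / (e pp x : ℝ)))
    (hsharp : ∀ (pp : Nat.Primes) (x : (thetaIndex X).Fibre (.inr pp)), haveI : Fact (pp : ℕ).Prime := ⟨pp.2⟩
      ∃ u : kOf X pp.1 x, ‖u‖ ≤ ‖ϖ pp x‖ ^ ((n₀ pp x : ℤ) - 1) ∧ u ∉ (logUnits (kOf X pp.1 x) : Set (kOf X pp.1 x)))
    (hrad : ∀ (pp : Nat.Primes) (x : (thetaIndex X).Fibre (.inr pp)), haveI : Fact (pp : ℕ).Prime := ⟨pp.2⟩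
      ∃ z ∈ (logUnits (kOf X pp.1 x) : Set (kOf X pp.1 x)), (pp : ℝ) ^ (lam pp x) ≤ ‖z‖)
    (ht1 : ∀ (pp : Nat.Primes) (i : Fin X.lstar) (x : (thetaIndex X).Fibre (.inr pp)),
      haveI : Fact (pp : ℕ).Prime := ⟨pp.2⟩; placeOf X pp.1 x ∉ X.S → ‖t pp i x‖ = 1)
    (hΘ : ∀ (pp : Nat.Primes) (i : Fin X.lstar) (w : (thetaIndex X).Fibre (.inr pp)), haveI : Fact (pp : ℕ).Prime := ⟨pp.2⟩
      placeOf X pp.1 w ∈ X.S → ‖t pp i w‖ = ‖ϖ pp w‖ ^ (mΘ pp i w))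
    (hq : ∀ (pp : Nat.Primes) (w : (thetaIndex X).Fibre (.inr pp)), haveI : Fact (pp : ℕ).Prime := ⟨pp.2⟩
      placeOf X pp.1 w ∈ X.S → ‖tq pp w‖ = ‖ϖ pp w‖ ^ (mq pp w))
    (hH : SlotReachWindow (thetaIndex X).lstar (fun pp => (thetaIndex X).Fibre (.inr pp))
      (fun pp w => haveI : Fact (pp : ℕ).Prime := ⟨pp.2⟩; placeOf X pp.1 w ∈ X.S) e n₀ lam mΘ mq) :
    Thm311ToCor312.Licence (settingPrVolSharp X hlog M archPk archSub Ψ act Mmod region n lat sig split qData tq t htq0 htq1) :=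
  licence_settingPrVolSharp_of_multiReach X hlog M archPk archSub Ψ act Mmod region n lat sig split qData tq t htq0 htq1
    fun pp i ev => multiReach_of_slotReachWindow X hlog tq t e n₀ lam ϖ mΘ mq htq1 he hϖ hsharp hrad ht1 hΘ hq hH pp i ev

end Setting


end Summit.ABC.IUTFork.Repair.RHSlotReachGlue

end
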